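import Summits.QuantumFields.BalabanUV.T4Continuum.Support.NE3CovariantLineSumsTower
import HarnessLib

/-!
# T⁴ programme, node NE3, row E-MLw-(w4)-P · C1 (file 3) — THE k-UNIFORM ESTIMATE OF THE ACCUMULATED ERROR:
# `‖ErrIter L (j+1) W Y‖_∞ ≤ 2·Ssum·L^j·‖Y‖_∞`, `Ssum = Σ_levels C_sup·16(d+1)(d+4)L²·(radius of the level)` — GEOMETRIC IN THE LEVEL,
# dominated by the top: in the class (`LevelSmall`, `L ≥ 2`) `Ssum ≤ (64∕3)(d+1)(d+4)L²·C_sup·(top radius) ≤ 1`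

NE3 formalisation swarm `b2b-balaban-t4-ne3-formalise-*`, LEAF PROVER 04 (gen 4), row **C1** of the owner's cut of the (w4)-P core
(D-ne3p1-g21-1 §3 (C1) ∕ §4), file 3 after `NE3CovariantLineSums` (p222840) and `NE3CovariantLineSumsTower` (the exact error recursion
`QbarIter = QstrIter + ErrIter`, one-level sup bounds).

CONTENT (all [folklore]; 0 sorry; DATA defs `Csup`, `wC`, `Ssum` (explicit real constants ∕ the level sum by structural recursion) → async audit):
§1 `Csup d L = 1250·(nbRad + L) + 8·dL + 2L`, `wC d L x = 16(d+1)(d+4)L²x · Csup` (the one-level relative defect), `Ssum d L (j+1) x = wC x + Ssum j (prop1Radius x)`;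
§2 global-sup one-level bounds `‖Qstr‖ ≤ L·s`, `‖Dstr‖ ≤ wC·s`, and `‖QstrIter L (j+1) W Y‖ ≤ L^{j+1}·s` (isometric transports, exact weight);
§3 **`norm_ErrIter_le`** — in the multi-level small-field class (hypotheses of `NE3TangentCovariantTower.dirIter_add`), for `‖Y‖_∞ ≤ s` and
   `Ssum d L (j+1) x ≤ L∕2`: `‖ErrIter L (j+1) W Y z κ‖ ≤ 2·Ssum d L (j+1) x · L^j · s` (induction through the exact recursion; the side condition
   is what keeps the induction linear);
§4 the class corollary: `Ssum_le_top` (`L ≥ 2`: `Ssum (j+1) x ≤ (4∕3)·wC((prop1Radius)^[j] x)`, since `prop1Radius x ≥ L²x ≥ 4x`),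
   `LevelSmall.top` (`twoLevelSmall·(prop1Radius)^[j] x ≤ 1`), the numeric `Ssum_le_one`, and **`norm_ErrIter_le_of_levelSmall`**:
   `‖ErrIter L (j+1) W Y z κ‖ ≤ (8∕3)·wC d L ((prop1Radius d L)^[j] x) · L^j · s` — relative to the main term `L^{j+1}·s` this is
   `O((d+1)(d+4)·L·(L^j)²x·Csup∕L^{?})`-small, k-FREE (no factor `j`), the quantitative half of «S_W = D_U μ + E».

HONEST: covariant kinematics of the linearised averaging tower on OUR frame (sup currency; the local-ℓ¹ currency of the owner's note is a
refinement left to C5∕the assembly); nothing about minimisers, (P_W), (ML_w), T-E_w or NE3 is asserted; NE3 NOT proved; spine 0∕9; finite T⁴ rung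
(B)+1 — NOT infinite volume, NOT mass gap, NOT BetaPertH, NOT Clay.  PLACEMENT: `Summits/QuantumFields/BalabanUV/`.
-/

set_option autoImplicit false

open scoped BigOperators Matrix.Norms.L2Operator
open Finset

namespace Summit.QuantumFields.BalabanUV.T4Continuum.NE3CovariantLineSumsError

open Literature.MathematicalPhysics.QuantumFieldTheory.Balaban1983to89
open B7Prop1Explicit B7Prop2Explicit
open T4AveragingDeficitWall (IsUnitaryCfg IsSkewDir SmallField Ad)
open AveragingDeficitChartCalculus (cavg)
open AveragingDeficitMultiLevelPrep (cavgIter LevelSmall prop1Radius_nonneg)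
open AveragingDeficitTwoLevelPrep (twoLevelSmall prop1Radius)
open BlockAverageVaryHolo (nbRad)
open NE3TangentCovariantTower (QbarIter step_small)
open NE3CovariantLineSums (Qstr)
open NE3CovariantLineSumsTower (Dstr QstrIter ErrIter QstrIter_succ QstrIter_zero ErrIter_succ ErrIter_zero QbarIter_eq_QstrIter_add_ErrIter
  norm_Qstr_le_sup norm_Dstr_le_sup)

noncomputable section

variable {d : ℕ} {n : Type*} [Fintype n] [DecidableEq n]

/-! ## §1 The constants and the level sum -/

/-- The sup-currency constant of the one-level defect: `Csup d L = 1250·(nbRad + L) + 8·dL + 2L`. [folklore] -/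
def Csup (d L : ℕ) : ℝ := 1250 * ((nbRad d L : ℝ) + L) + 8 * (d * L) + 2 * L

/-- The one-level relative defect at radius `x`: `wC d L x = 16(d+1)(d+4)L²x · Csup d L`. [folklore] -/
def wC (d L : ℕ) (x : ℝ) : ℝ := (16 * (d + 1) * (d + 4) * (L : ℝ) ^ 2 * x) * Csup d L

/-- THE LEVEL SUM of the relative defects along the tower (inner-first, like `LevelSmall`): `Ssum 0 x = 0`,
`Ssum (j+1) x = wC x + Ssum j (prop1Radius x)`. [folklore] -/
def Ssum (d L : ℕ) : ℕ → ℝ → ℝ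
  | 0, _ => 0
  | j + 1, x => wC d L x + Ssum d L j (prop1Radius d L x)

omit [Fintype n] [DecidableEq n] in
/-- `0 ≤ Csup`. [folklore] -/
theorem Csup_nonneg (d L : ℕ) : 0 ≤ Csup d L := by unfold Csup; positivity

/-- `0 ≤ wC x` for `x ≥ 0`. [folklore] -/
theorem wC_nonneg (d L : ℕ) {x : ℝ} (hx : 0 ≤ x) : 0 ≤ wC d L x := by
  unfold wC; have := Csup_nonneg d L; positivity

/-- `0 ≤ Ssum j x` for `x ≥ 0`. [folklore] -/
theorem Ssum_nonneg (d L : ℕ) : ∀ (j : ℕ) {x : ℝ}, 0 ≤ x → 0 ≤ Ssum d L j x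
  | 0, _, _ => le_rfl
  | j + 1, _, hx => add_nonneg (wC_nonneg d L hx) (Ssum_nonneg d L j (prop1Radius_nonneg hx))

/-- `Ssum (j+1) x = wC x + Ssum j (prop1Radius x)`. [folklore] -/
theorem Ssum_succ (d L j : ℕ) (x : ℝ) : Ssum d L (j + 1) x = wC d L x + Ssum d L j (prop1Radius d L x) := rfl

/-! ## §2 Global-sup one-level bounds and the straight tower -/

/-- `‖Qstr L W Y z κ‖ ≤ L·s` for `‖Y‖_∞ ≤ s` (unitary small-field `W`). [folklore] -/
theorem norm_Qstr_le_of_sup [Nonempty n] {L : ℕ} (hL : 1 ≤ L) {W : Site d → Fin d → (Matrix n n ℂ)ˣ} (hWu : IsUnitaryCfg W)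
    {a : ℝ} (ha : 0 ≤ a) (hsmall : 512 * (d + 1) * (d + 4) * (L : ℝ) ^ 2 * a ≤ 1) (hWa : SmallField W a)
    {Y : Site d → Fin d → Matrix n n ℂ} {s : ℝ} (hs : ∀ (y : Site d) (μ : Fin d), ‖Y y μ‖ ≤ s) (z : Site d) (κ : Fin d) :
    ‖Qstr L W Y z κ‖ ≤ L * s :=
  norm_Qstr_le_sup hL hWu ha hsmall hWa Y z κ fun y μ _ => hs y μ

/-- `‖Dstr L W Y z κ‖ ≤ wC d L a · s` for `‖Y‖_∞ ≤ s` (unitary `W` with `SmallField W a`, `512(d+1)(d+4)L²a ≤ 1`). [folklore] -/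
theorem norm_Dstr_le_of_sup [Nonempty n] {L : ℕ} (hL : 1 ≤ L) {W : Site d → Fin d → (Matrix n n ℂ)ˣ} (hWu : IsUnitaryCfg W)
    {a : ℝ} (ha : 0 ≤ a) (hsmall : 512 * (d + 1) * (d + 4) * (L : ℝ) ^ 2 * a ≤ 1) (hWa : SmallField W a)
    {Y : Site d → Fin d → Matrix n n ℂ} {s : ℝ} (hs : ∀ (y : Site d) (μ : Fin d), ‖Y y μ‖ ≤ s) (z : Site d) (κ : Fin d) :
    ‖Dstr L W Y z κ‖ ≤ wC d L a * s := by
  have h := norm_Dstr_le_sup hL hWu ha hsmall hWa Y z κ fun y μ _ => hs y μ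
  unfold wC Csup
  linarith

/-- **THE STRAIGHT TOWER PROPAGATES THE SUP WITH EXACT WEIGHT**: in the multi-level small-field class, `‖Y‖_∞ ≤ s ⇒ ‖QstrIter L (j+1) W Y‖_∞ ≤ L^{j+1}·s`.
[folklore] -/
theorem norm_QstrIter_le_of_sup [Nonempty n] {L : ℕ} (hL : 1 ≤ L) (j : ℕ) :
    ∀ {W : Site d → Fin d → (Matrix n n ℂ)ˣ} {x : ℝ}, IsUnitaryCfg W → 0 ≤ x → LevelSmall d L j x → SmallField W x →
    ∀ {Y : Site d → Fin d → Matrix n n ℂ} {s : ℝ}, (∀ (y : Site d) (μ : Fin d), ‖Y y μ‖ ≤ s) →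
      ∀ (z : Site d) (κ : Fin d), ‖QstrIter L (j + 1) W Y z κ‖ ≤ (L : ℝ) ^ (j + 1) * s := by
  induction j with
  | zero =>
      intro W x hWu hx hsm hWx Y s hs z κ
      obtain ⟨h512, -, -, -⟩ := step_small hL hWu hx hsm hWx
      rw [zero_add, pow_one, QstrIter_succ, QstrIter_zero]
      exact norm_Qstr_le_of_sup hL hWu hx h512 hWx hs z κ
  | succ j ih =>
      intro W x hWu hx hsm hWx Y s hs z κ
      obtain ⟨h512, hW₁u, hr0, hW₁x⟩ := step_small hL hWu hx hsm.1 hWx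
      rw [QstrIter_succ]
      have h := ih hW₁u hr0 hsm.2 hW₁x (fun y μ => norm_Qstr_le_of_sup hL hWu hx h512 hWx hs y μ) z κ
      calc ‖QstrIter L (j + 1) (cavg L W) (Qstr L W Y) z κ‖ ≤ (L : ℝ) ^ (j + 1) * (L * s) := h
        _ = (L : ℝ) ^ (j + 1 + 1) * s := by ring

/-! ## §3 The accumulated error -/

/-- **THE k-UNIFORM ESTIMATE OF THE ACCUMULATED ERROR** (sup currency): in the multi-level small-field class, for `‖Y‖_∞ ≤ s`, `s ≥ 0` and
the level sum `Ssum d L (j+1) x ≤ L∕2`,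
`‖ErrIter L (j+1) W Y z κ‖ ≤ 2 · Ssum d L (j+1) x · L^j · s`.
Induction through the exact recursion `ErrIter (j+2) W Y = ErrIter (j+1) W₁ (Qstr W Y) + QbarIter (j+1) W₁ (Dstr W Y)` and
`QbarIter = QstrIter + ErrIter`; the side condition keeps the recursion linear. [folklore] -/
theorem norm_ErrIter_le [Nonempty n] {L : ℕ} (hL : 1 ≤ L) (j : ℕ) :
    ∀ {W : Site d → Fin d → (Matrix n n ℂ)ˣ} {x : ℝ}, IsUnitaryCfg W → 0 ≤ x → LevelSmall d L j x → SmallField W x →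
    Ssum d L (j + 1) x ≤ (L : ℝ) / 2 →
    ∀ {Y : Site d → Fin d → Matrix n n ℂ} {s : ℝ}, 0 ≤ s → (∀ (y : Site d) (μ : Fin d), ‖Y y μ‖ ≤ s) →
      ∀ (z : Site d) (κ : Fin d), ‖ErrIter L (j + 1) W Y z κ‖ ≤ 2 * Ssum d L (j + 1) x * (L : ℝ) ^ j * s := by
  induction j with
  | zero =>
      intro W x hWu hx hsm hWx _ Y s hs0 hs z κ
      obtain ⟨h512, -, -, -⟩ := step_small hL hWu hx hsm hWx
      rw [zero_add, ErrIter_succ]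
      simp only [ErrIter_zero, NE3TangentCovariantTower.QbarIter_zero, zero_add, pow_zero, mul_one]
      have h := norm_Dstr_le_of_sup hL hWu hx h512 hWx hs z κ
      have hS : Ssum d L 1 x = wC d L x := by rw [Ssum_succ]; simp [Ssum]
      rw [hS]
      have hw0 := wC_nonneg d L hx
      nlinarith
  | succ j ih =>
      intro W x hWu hx hsm hWx hS Y s hs0 hs z κ
      obtain ⟨h512, hW₁u, hr0, hW₁x⟩ := step_small hL hWu hx hsm.1 hWx
      have hL0 : (0 : ℝ) < L := by exact_mod_cast (by omega : 0 < L)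
      -- the level sum splits: S = wC x + S', with S' the level sum from the next level on
      set S' : ℝ := Ssum d L (j + 1) (prop1Radius d L x) with hS'def
      have hSsplit : Ssum d L (j + 1 + 1) x = wC d L x + S' := Ssum_succ d L (j + 1) x
      have hw0 : 0 ≤ wC d L x := wC_nonneg d L hx
      have hS'0 : 0 ≤ S' := Ssum_nonneg d L (j + 1) hr0
      have hS'le : S' ≤ (L : ℝ) / 2 := by linarith
      -- sup of the two level-0 pieces
      have hQs : ∀ (y : Site d) (μ : Fin d), ‖Qstr L W Y y μ‖ ≤ L * s := norm_Qstr_le_of_sup hL hWu hx h512 hWx hs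
      have hDs : ∀ (y : Site d) (μ : Fin d), ‖Dstr L W Y y μ‖ ≤ wC d L x * s := norm_Dstr_le_of_sup hL hWu hx h512 hWx hs
      have hLs0 : 0 ≤ (L : ℝ) * s := by positivity
      have hws0 : 0 ≤ wC d L x * s := by positivity
      -- first term: the IH at W₁ on the direction `Qstr W Y`
      have h1 := ih hW₁u hr0 hsm.2 hW₁x hS'le hLs0 hQs z κ
      -- second term: `QbarIter = QstrIter + ErrIter` at W₁ on the direction `Dstr W Y`
      have h2a := norm_QstrIter_le_of_sup hL j hW₁u hr0 hsm.2 hW₁x hDs z κ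
      have h2b := ih hW₁u hr0 hsm.2 hW₁x hS'le hws0 hDs z κ
      have h2 : ‖QbarIter L (j + 1) (cavg L W) (Dstr L W Y) z κ‖
          ≤ (L : ℝ) ^ (j + 1) * (wC d L x * s) + 2 * S' * (L : ℝ) ^ j * (wC d L x * s) := by
        rw [QbarIter_eq_QstrIter_add_ErrIter hL j hW₁u hr0 hsm.2 hW₁x (Dstr L W Y)]
        exact (norm_add_le _ _).trans (add_le_add h2a h2b)
      rw [ErrIter_succ, hSsplit]
      refine (norm_add_le _ _).trans ((add_le_add h1 h2).trans ?_)
      -- `2S'L^j(Ls) + L^{j+1}·wC·s + 2S'L^j·wC·s ≤ 2(wC + S')·L^{j+1}·s` iff `S' ≤ L∕2`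
      have hLj : (0 : ℝ) ≤ (L : ℝ) ^ j := by positivity
      have key : 2 * S' * (L : ℝ) ^ j * (wC d L x * s) ≤ (L : ℝ) ^ j * L * (wC d L x * s) := by
        have : 2 * S' ≤ (L : ℝ) := by linarith
        nlinarith [mul_nonneg hLj hws0]
      have e : (L : ℝ) ^ (j + 1) = (L : ℝ) ^ j * L := pow_succ _ _
      rw [e]
      nlinarith [key, mul_nonneg hLj hws0, mul_nonneg hLj hLs0, hS'0, hw0]

/-! ## §4 Inside the class: the level sum is dominated by the top level -/

/-- `prop1Radius x ≥ L²·x`. [folklore] -/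
theorem sq_mul_le_prop1Radius (L : ℕ) (x : ℝ) : (L : ℝ) ^ 2 * x ≤ prop1Radius d L x := by
  unfold prop1Radius; nlinarith [sq_nonneg (8 * ((d : ℝ) + 1) * ((d : ℝ) + 4) * (L : ℝ) ^ 2 * x)]

/-- For `L ≥ 2`: `4·wC x ≤ wC (prop1Radius x)` (`x ≥ 0`). [folklore] -/
theorem four_mul_wC_le {L : ℕ} (hL : 2 ≤ L) {x : ℝ} (hx : 0 ≤ x) : 4 * wC d L x ≤ wC d L (prop1Radius d L x) := by
  have hL2 : (4 : ℝ) ≤ (L : ℝ) ^ 2 := by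
    have : (2 : ℝ) ≤ L := by exact_mod_cast hL
    nlinarith
  have hp := sq_mul_le_prop1Radius (d := d) L x
  have h4 : 4 * x ≤ prop1Radius d L x := le_trans (by nlinarith) hp
  have hC := Csup_nonneg d L
  unfold wC
  have h16 : (0 : ℝ) ≤ 16 * (d + 1) * (d + 4) * (L : ℝ) ^ 2 := by positivity
  nlinarith [mul_le_mul_of_nonneg_left h4 h16, mul_nonneg h16 hx]

/-- **GEOMETRIC DOMINATION BY THE TOP LEVEL** (`L ≥ 2`, `x ≥ 0`):
`Ssum d L (j+1) x ≤ (4∕3)·wC ((prop1Radius)^[j] x) − (1∕3)·wC x`. [folklore] -/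
theorem Ssum_le_top {L : ℕ} (hL : 2 ≤ L) : ∀ (j : ℕ) {x : ℝ}, 0 ≤ x →
    Ssum d L (j + 1) x ≤ 4 / 3 * wC d L ((prop1Radius d L)^[j] x) - 1 / 3 * wC d L x
  | 0, x, _ => by
      rw [Ssum_succ]; simp only [Ssum, add_zero, Function.iterate_zero, id_eq]; linarith
  | j + 1, x, hx => by
      rw [Ssum_succ, Function.iterate_succ_apply]
      have ih := Ssum_le_top hL j (prop1Radius_nonneg (d := d) (L := L) hx)
      have h4 := four_mul_wC_le (d := d) hL hx
      linarith

omit [Fintype n] [DecidableEq n] in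
/-- The iterated radii are non-negative. [folklore] -/
theorem iterate_prop1Radius_nonneg {L : ℕ} : ∀ (j : ℕ) {x : ℝ}, 0 ≤ x → 0 ≤ (prop1Radius d L)^[j] x
  | 0, _, hx => hx
  | j + 1, _, hx => by
      rw [Function.iterate_succ_apply]
      exact iterate_prop1Radius_nonneg j (prop1Radius_nonneg hx)

omit [Fintype n] [DecidableEq n] in
/-- Every level of `LevelSmall` bounds its own radius: `LevelSmall d L j x ⇒ twoLevelSmall·(prop1Radius)^[j] x ≤ 1`. [folklore] -/
theorem LevelSmall.top {L : ℕ} : ∀ {j : ℕ} {x : ℝ}, LevelSmall d L j x → twoLevelSmall d L * (prop1Radius d L)^[j] x ≤ 1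
  | 0, _, h => h
  | j + 1, _, h => by
      rw [Function.iterate_succ_apply]
      exact LevelSmall.top h.2

omit [Fintype n] [DecidableEq n] in
/-- The numeric comparison of the class constants: `64(d+1)(d+4)L²·Csup d L ≤ 3·twoLevelSmall d L` (`L ≥ 1`). [folklore] -/
theorem wC_const_le {L : ℕ} (hL : 1 ≤ L) : 64 * ((d : ℝ) + 1) * ((d : ℝ) + 4) * (L : ℝ) ^ 2 * Csup d L ≤ 3 * twoLevelSmall d L := by
  unfold Csup twoLevelSmall nbRad
  have hL1 : (1 : ℝ) ≤ L := by exact_mod_cast hL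
  have hd : (0 : ℝ) ≤ d := Nat.cast_nonneg d
  have hLd : (L : ℝ) ^ 3 ≤ (L : ℝ) ^ (d + 4) := by
    calc (L : ℝ) ^ 3 = (L : ℝ) ^ 3 * 1 := by ring
      _ ≤ (L : ℝ) ^ 3 * (L : ℝ) ^ (d + 1) := mul_le_mul_of_nonneg_left (one_le_pow₀ hL1) (by positivity)
      _ = (L : ℝ) ^ (d + 4) := by ring
  push_cast
  -- `Csup = (2508 d + 3752)·L`; `64(d+1)(d+4)L²·Csup = 64(d+1)(d+4)(2508d+3752)L³ ≤ 3·65536(d+1)²(d+4)² L^{d+4}`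
  have h1 : 1250 * (2 * ((d : ℝ) * L) + 2 * L + L) + 8 * ((d : ℝ) * L) + 2 * L = (2508 * d + 3752) * (L : ℝ) := by ring
  rw [h1]
  have hA : (0 : ℝ) ≤ 64 * ((d : ℝ) + 1) * ((d : ℝ) + 4) * (2508 * d + 3752) := by positivity
  have hB : 64 * ((d : ℝ) + 1) * ((d : ℝ) + 4) * (2508 * d + 3752) ≤ 3 * (65536 * ((d : ℝ) + 1) ^ 2 * ((d : ℝ) + 4) ^ 2) := by
    nlinarith [mul_nonneg hd hd, mul_nonneg (mul_nonneg hd hd) hd]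
  calc 64 * ((d : ℝ) + 1) * ((d : ℝ) + 4) * (L : ℝ) ^ 2 * ((2508 * d + 3752) * (L : ℝ))
      = (64 * ((d : ℝ) + 1) * ((d : ℝ) + 4) * (2508 * d + 3752)) * (L : ℝ) ^ 3 := by ring
    _ ≤ (3 * (65536 * ((d : ℝ) + 1) ^ 2 * ((d : ℝ) + 4) ^ 2)) * (L : ℝ) ^ (d + 4) :=
        mul_le_mul hB hLd (by positivity) (by positivity)
    _ = 3 * (65536 * ((d : ℝ) + 1) ^ 2 * ((d : ℝ) + 4) ^ 2 * (L : ℝ) ^ (d + 4)) := by ring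

/-- **IN THE CLASS THE LEVEL SUM IS AT MOST ONE** (`L ≥ 2`): `LevelSmall d L j x`, `x ≥ 0` ⇒ `Ssum d L (j+1) x ≤ (4∕3)·wC((prop1Radius)^[j] x) ≤ 1`.
[folklore] -/
theorem Ssum_le_one {L : ℕ} (hL : 2 ≤ L) {j : ℕ} {x : ℝ} (hx : 0 ≤ x) (hs : LevelSmall d L j x) :
    Ssum d L (j + 1) x ≤ 4 / 3 * wC d L ((prop1Radius d L)^[j] x) ∧ 4 / 3 * wC d L ((prop1Radius d L)^[j] x) ≤ 1 := by
  have htop := LevelSmall.top (d := d) hs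
  have hnum := wC_const_le (d := d) (L := L) (by omega)
  have h1 := Ssum_le_top (d := d) hL j hx
  have hw0 := wC_nonneg d L hx
  refine ⟨by linarith, ?_⟩
  -- `(4∕3)·16(d+1)(d+4)L²·r·Csup ≤ 1` from `tls·r ≤ 1` and `64(d+1)(d+4)L²Csup ≤ 3·tls`
  have hr0 : 0 ≤ (prop1Radius d L)^[j] x := iterate_prop1Radius_nonneg (d := d) j hx
  set r : ℝ := (prop1Radius d L)^[j] x with hr
  have htls0 : 0 ≤ twoLevelSmall d L := by unfold twoLevelSmall; positivity
  unfold wC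
  have hC := Csup_nonneg d L
  nlinarith [mul_le_mul_of_nonneg_right htop hC, mul_nonneg htls0 hr0, mul_nonneg hr0 hC]

/-- **THE ACCUMULATED ERROR IN THE CLASS** (`L ≥ 2`): for unitary `W` with `SmallField W x`, `0 ≤ x`, `LevelSmall d L j x`, and `‖Y‖_∞ ≤ s`:
`‖ErrIter L (j+1) W Y z κ‖ ≤ (8∕3)·wC d L ((prop1Radius d L)^[j] x) · L^j · s` — k-FREE: no factor `j`; the top-level radius only. [folklore] -/
theorem norm_ErrIter_le_of_levelSmall [Nonempty n] {L : ℕ} (hL : 2 ≤ L) (j : ℕ) {W : Site d → Fin d → (Matrix n n ℂ)ˣ} {x : ℝ}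
    (hWu : IsUnitaryCfg W) (hx : 0 ≤ x) (hs : LevelSmall d L j x) (hWx : SmallField W x)
    {Y : Site d → Fin d → Matrix n n ℂ} {s : ℝ} (hs0 : 0 ≤ s) (hY : ∀ (y : Site d) (μ : Fin d), ‖Y y μ‖ ≤ s) (z : Site d) (κ : Fin d) :
    ‖ErrIter L (j + 1) W Y z κ‖ ≤ 8 / 3 * wC d L ((prop1Radius d L)^[j] x) * (L : ℝ) ^ j * s := by
  obtain ⟨hS1, hS2⟩ := Ssum_le_one (d := d) hL hx hs
  have hL2 : (2 : ℝ) ≤ L := by exact_mod_cast hL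
  have hside : Ssum d L (j + 1) x ≤ (L : ℝ) / 2 := by linarith
  have h := norm_ErrIter_le (by omega) j hWu hx hs hWx hside hs0 hY z κ
  have hLj : (0 : ℝ) ≤ (L : ℝ) ^ j * s := by positivity
  nlinarith [mul_le_mul_of_nonneg_right hS1 hLj]

end

end Summit.QuantumFields.BalabanUV.T4Continuum.NE3CovariantLineSumsError
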